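import Summits.BirchSwinnertonDyer.Rank1Residual.Additive.X4ThreeKuriharaCertKernel
import Summits.BirchSwinnertonDyer.Rank1Residual.Additive.PlusSymbolIntegrality
import HarnessLib

/-!
# N11 LOWER@3 Kurihara-certificate records: the `Ω⁺_f`-INTEGRALITY binder DISCHARGED on every tower
# row (p09's `PlusSymbolIntegrality`, team row T-R18b) — the record shapes of
# `Additive/X4ThreeKuriharaCertKernel.lean` WITHOUT `hint`
# (cell `b2b-bsdres`, team n1011, seat p03, OWNERS row T-a2-REC; sequel of the kernel tool p253917)

HONEST FRAMING (cell `b2b-bsdres`, run/shared/lean/b2b/bsd-rank1-residual/, verbatim in every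
file): the goal of the cell is to DELETE the COMBINATION-SHAPED residual classes of the
Birch–Swinnerton-Dyer formula for ALL analytic-rank `≤ 1` elliptic curves over `ℚ` — "full BSD
formula for every rank `≤ 1` curve in class `C`" assembled STRICTLY from published theorems — so
that the rank-`≤ 1` remainder becomes exactly the CONSTRUCTION-SHAPED classes, which are TYPED
(missing-input `Prop`s), NOT attempted. This is not "finishing BSD". Team n1011 is a RESEARCH ROUTE;
no claim beyond the stated classes; the label X4 and the mark of RESIDUAL-MAP §I N11 (LOWER@3) are
UNCHANGED; nothing is booked (records are EVIDENCE-grade CANDIDATES for the director). Every theorem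
below is CONDITIONAL on the ANNOUNCED C.-H. Kim (app. R. Pollack), arXiv:2505.09121v1 (2025, PREPRINT)
Thm. 1.1 PRIMARY record `hK25s`, FLAG `Kim2025-preprint`. Theorems only (no definition, no named fact,
no new `Prop`).

## What this file proves

The kernel tool `X4ThreeKuriharaCertKernel.lean` (§4–§5) carries the `Ω⁺_{D.f}`-integrality binder
`hint : ∀ r, [r]⁺_{D.f} ≠ 0 → 0 ≤ ord₃ [r]⁺_{D.f}` of the [K25] own-currency records (flag
`Kim2025-OmegaE-integrality`, §(η) η.7: the `[int]` bit = census covariate `a(E) = 0`). Team n1011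
seat p09 (row T-R18b) has since PROVED it on every row with `E[p]` irreducible, `p` odd — Drinfeld's
operator `T_ℓ − ℓ − 1` at every cusp (`Additive/PlusSymbolIntegrality.lean`,
`forall_padicValRat_ratPlusSymbol_nonneg_of_towerSurj`). On the tower rows of the records (`ρ̄_{E,3^n}`
onto ∀ `n`, so surj(3) and `E[3]` irreducible) the binder is therefore a THEOREM, and the record
shapes lose it:

* `X4RankZero.bsdp_three_of_intModel_of_optimal_of_towerSurj_of_kuriharaUnitAt` — unit row: integer
  model with `3 ∣ Δ`, `3 ∣ c₄`; the `3`-adic tower; `r_an = 0`; `3 ∤ ∏ c_ℓ`; OPTIMAL datum at level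
  `N ≤ 130000`; ONE unit Kurihara number of `D.f` at a cyclic `n ∈ 𝒩₁(E,3)` ⟹ `BSDp W 3 ∧ MissingPPartAt W 3`.
* `X4RankZero.missingLowerBoundAt_three_of_optimal_of_towerSurj_of_kuriharaIndexLeAt` and
  `X4RankZero.bsdp_three_of_optimal_of_towerSurj_of_kuriharaIndexLeAt_of_cov` — Tamagawa-defect rows.
Consequence for the records (`Additive/X4ThreeKuriharaCertRecords*.lean`): the per-pair EVIDENCE
binders are exactly `r_an = 0`, `3 ∤ ∏ c_ℓ` (resp. the local Tamagawa / `hcov` reading), the optimal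
datum (Cremona), and the Kurihara LEVEL + VALUE (two engines); and — since integrality is now a
theorem on these rows — the engines' minimal-lattice normalisation agrees with the tree's
`Ω⁺_f`-normalisation up to a `3`-adic unit exactly when the measured offset `μ(E)` vanishes, which
§(η) η.7 predicts on every surj(3) row (S-MU line of PREDICTIONS-E2-AT3; a non-zero `μ` is an ANOMALY).

References: [Kim2025RefinedTNC] Thm. 1.1, Cor. 1.7 (PREPRINT); [Kim2022StructureSelmer] §1.4.1, §1.5.1;
[AgasheRibetStein2006] Thm. 2.6; [Kato2004Asterisque] Thm. 14.5 (3); [Miller2011LMS] Def. 1.1; Manin 1972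
/ Drinfeld 1973 (cusps are torsion) as used in p09's file; cell files cells/n1011/skel/T-a2-REC.md,
cells/n1011/skel/T-R18b.md, cells/n1011/KIM-AT-3-ANATOMY.md §(η) η.7.
-/

noncomputable section

open scoped Classical MatrixGroups ModularForm

open CongruenceSubgroup WeierstrassCurve Literature.NumberTheory.EllipticCurves
  Literature.NumberTheory.EllipticCurves.ModularForms
  Literature.NumberTheory.EllipticCurves.Rank1Residual
  Literature.NumberTheory.EllipticCurves.Rank1Residual.Typed
  Literature.NumberTheory.EllipticCurves.AgasheRibetStein2006
  Summit.BirchSwinnertonDyer.BirchSwinnertonDyer.Rank1Residual.IntModel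

namespace Summit.BirchSwinnertonDyer.Rank1Residual.Additive

open Summit.BirchSwinnertonDyer.Rank1Residual.X4

variable (W : WeierstrassCurve ℚ) [W.IsElliptic] [W.IsGloballyMinimal]

/-- **T-a2-REC unit-row shape, integrality DISCHARGED**: globally minimal elliptic `W/ℚ` with integer
model `E₀`, `3 ∣ Δ(E₀)`, `3 ∣ c₄(E₀)` (ADDITIVE at `3`); the `3`-adic tower (large image; gives
surj(3), class X4, AND the `Ω⁺_{D.f}`-integrality by p09's
`forall_padicValRat_ratPlusSymbol_nonneg_of_towerSurj`); `r_an = 0`; `3 ∤ ∏ c_ℓ`; an OPTIMAL datum `D`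
at level `N ≤ 130000`; ONE unit Kurihara number of `D.f` at a cyclic `n ∈ 𝒩₁(E,3)` ⟹
`BSD(E,3) ∧ MissingPPartAt W 3`, CONDITIONAL on the [K25] PRIMARY record `hK25s` (FLAG
`Kim2025-preprint`), GZK, modularity, ARS Thm. 2.6 (`h26`). Per pair; nothing booked.
[claim: Kim2025RefinedTNC, status: under-review]
[cite: Kim2025RefinedTNC, Thm. 1.1 ("BSD"), Cor. 1.7, App. §8.1.1 (ANNOUNCED preprint — the reason, not a source of truth)]
[cite: AgasheRibetStein2006, Thm. 2.6 (p. 619)] [cite: SilvermanAEC2009, VII.5 Prop. 5.1 (c)]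
[cite: Miller2011LMS, §1 and Def. 1.1] -/
theorem X4RankZero.bsdp_three_of_intModel_of_optimal_of_towerSurj_of_kuriharaUnitAt
    (hK25s : Kim2025.thm11_kimShaLength_of_integralPeriod_OPEN)
    (hGZK : rank_eq_analyticRank_of_analyticRank_le_one) (hmod : hasEntireLFunction_rat)
    (h26 : cremona_abs_maninConstant_eq_one_of_level_le)
    {E₀ : WeierstrassCurve ℤ} (hI : integralModelInt W = E₀)
    (hΔ : (3 : ℤ) ∣ E₀.Δ) (hc₄ : (3 : ℤ) ∣ E₀.c₄)
    (htower : ∀ n : ℕ, W.HasSurjectiveModNGaloisRep (3 ^ n : ℕ))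
    (hr : W.analyticRank = 0) (htam : ¬ 3 ∣ W.tamagawaProduct)
    {N : ℕ} [NeZero N] (hN : N ≤ 130000) (D : ModularParametrizationData W N)
    (hopt : ∀ z ∈ D.L.lattice, ∃ w ∈ periodLattice D.f, z = D.c * w)
    (hK : haveI : Fact (Nat.Prime 3) := ⟨Nat.prime_three⟩; X4.KuriharaUnitAt W 3 D.f) :
    haveI : Fact (Nat.Prime 3) := ⟨Nat.prime_three⟩
    BSDp W 3 ∧ MissingPPartAt W 3 :=
  haveI : Fact (Nat.Prime 3) := ⟨Nat.prime_three⟩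
  X4RankZero.bsdp_three_of_intModel_of_optimal_of_kuriharaUnitAt W hK25s hGZK hmod h26 hI hΔ hc₄ htower
    hr htam hN D hopt (forall_padicValRat_ratPlusSymbol_nonneg_of_towerSurj (by norm_num) D.isNewformOf htower)
    hK

/-- **T-a2-REC Tamagawa-defect shape, LOWER half, integrality DISCHARGED** (tower row, `r_an = 0`,
optimal datum at level `N ≤ 130000`, certificate `KuriharaIndexLeAt W 3 D.f (ord₃ ∏ c_ℓ)`) ⟹
`Typed.MissingLowerBoundAt W 3`, CONDITIONAL on `hK25s`. Per pair; nothing booked.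
[claim: Kim2025RefinedTNC, status: under-review]
[cite: Kim2025RefinedTNC, Thm. 1.1 ("BSD"), App. §8.1.2 (ANNOUNCED preprint — the reason, not a source of truth)]
[cite: Kim2022StructureSelmer, Conj. 1.10 and §1.5.1 (PDF pp. 7–8)] [cite: AgasheRibetStein2006, Thm. 2.6 (p. 619)] -/
theorem X4RankZero.missingLowerBoundAt_three_of_optimal_of_towerSurj_of_kuriharaIndexLeAt
    (hK25s : Kim2025.thm11_kimShaLength_of_integralPeriod_OPEN)
    (hGZK : rank_eq_analyticRank_of_analyticRank_le_one) (hmod : hasEntireLFunction_rat)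
    (h26 : cremona_abs_maninConstant_eq_one_of_level_le)
    (htower : ∀ n : ℕ, W.HasSurjectiveModNGaloisRep (3 ^ n : ℕ)) (hr : W.analyticRank = 0)
    {N : ℕ} [NeZero N] (hN : N ≤ 130000) (D : ModularParametrizationData W N)
    (hopt : ∀ z ∈ D.L.lattice, ∃ w ∈ periodLattice D.f, z = D.c * w)
    (hK : haveI : Fact (Nat.Prime 3) := ⟨Nat.prime_three⟩;
      KuriharaIndexLeAt W 3 D.f (padicValNat 3 W.tamagawaProduct)) :
    haveI : Fact (Nat.Prime 3) := ⟨Nat.prime_three⟩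
    MissingLowerBoundAt W 3 :=
  haveI : Fact (Nat.Prime 3) := ⟨Nat.prime_three⟩
  X4RankZero.missingLowerBoundAt_three_of_optimal_of_kuriharaIndexLeAt W hK25s hGZK hmod h26 htower hr hN D
    hopt (forall_padicValRat_ratPlusSymbol_nonneg_of_towerSurj (by norm_num) D.isNewformOf htower) hK

/-- **T-a2-REC Tamagawa-defect shape, `BSD(E,3)`, integrality DISCHARGED**: LOWER from the level-`k`
certificate plus UPPER on the covered locus `hcov` (`ord₃ j < 0`: (M) chain; else tower ∧
`ord₃ ∏ c_ℓ = ord₃ c₃` ∧ Manin datum: sharp Kato A161, FLAG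
`Kato-14.5(3)-14.16(2)-additive-potgood-reading-sharp`), CONDITIONAL on `hK25s`. Per pair; nothing booked.
[claim: Kim2025RefinedTNC, status: under-review]
[cite: Kim2025RefinedTNC, Thm. 1.1 ("BSD"), App. §8.1.2 (ANNOUNCED preprint — the reason, not a source of truth)]
[cite: Kato2004Asterisque, Thm. 14.5 (3) (p. 236), Prop. 14.16 (2) (p. 244)]
[cite: AgasheRibetStein2006, Thm. 2.6 (p. 619)] [cite: Miller2011LMS, §1 and Def. 1.1] -/
theorem X4RankZero.bsdp_three_of_optimal_of_towerSurj_of_kuriharaIndexLeAt_of_cov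
    (hK25s : Kim2025.thm11_kimShaLength_of_integralPeriod_OPEN)
    (hKatoS : Kato2004.rankZero_padicValNat_sha_le_sub_localTamagawa_of_additive_potGood_of_imageContainsSL2)
    (hDel : Delbourgo1998.prop4_rankZero_pow_dvd_constantCoeff)
    (hGZK : rank_eq_analyticRank_of_analyticRank_le_one) (hmod : hasEntireLFunction_rat)
    (hmodD : nonempty_modularParametrizationData)
    (hL20 : Wuthrich2014.lemma20_surjective_threeAdic_of_semistable)
    (hKatoχ : Wuthrich2014.kato_halfEigenCharIdeal_dvd_cyclotomicPrime_of_surjective)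
    (h26 : cremona_abs_maninConstant_eq_one_of_level_le)
    {E₀ : WeierstrassCurve ℤ} (hI : integralModelInt W = E₀)
    (hΔ : (3 : ℤ) ∣ E₀.Δ) (hc₄ : (3 : ℤ) ∣ E₀.c₄)
    (htower : ∀ n : ℕ, W.HasSurjectiveModNGaloisRep (3 ^ n : ℕ)) (hr : W.analyticRank = 0)
    (hcov : padicValRat 3 W.j < 0 ∨
      padicValNat 3 W.tamagawaProduct =
        padicValNat 3 ((W.baseChange ℚ_[3]).localTamagawaNumber ℤ_[3]))
    {N : ℕ} [NeZero N] (hN : N ≤ 130000) (D : ModularParametrizationData W N)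
    (hopt : ∀ z ∈ D.L.lattice, ∃ w ∈ periodLattice D.f, z = D.c * w)
    (hK : haveI : Fact (Nat.Prime 3) := ⟨Nat.prime_three⟩;
      KuriharaIndexLeAt W 3 D.f (padicValNat 3 W.tamagawaProduct)) :
    haveI : Fact (Nat.Prime 3) := ⟨Nat.prime_three⟩
    BSDp W 3 :=
  haveI : Fact (Nat.Prime 3) := ⟨Nat.prime_three⟩
  X4RankZero.bsdp_three_of_optimal_of_kuriharaIndexLeAt_of_cov W hK25s hKatoS hDel hGZK hmod hmodD hL20 hKatoχ
    h26 hI hΔ hc₄ htower hr hcov hN D hopt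
    (forall_padicValRat_ratPlusSymbol_nonneg_of_towerSurj (by norm_num) D.isNewformOf htower) hK

end Summit.BirchSwinnertonDyer.Rank1Residual.Additive

end
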